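import Literature.NumberTheory.QuadraticFields.RedeiReichardtPrincipalAmbiguous
import HarnessLib

/-!
# A ramified prime of `ℚ(√-n)` above a proper prime divisor of `n` is not principal

Topic `NumberTheory/QuadraticFields`, namespace `Literature.NumberTheory.QuadraticFields.RedeiReichardt`.
Theorem-only file (no definition, no named fact), a corollary of the tree's Stevenhagen §2 lemma
`eq_zero_or_eq_indicator_of_isPrincipal` (`RedeiReichardtPrincipalAmbiguous`: a principal product of
ramified primes of `K ∋ √-n` is `(1)` or `(√-n) = ∏_{p ∣ n} 𝔭_p`).

Let `K` be a quadratic field containing `x` with `x² = -n`, `n` square-free, and let `q ∣ n` be a prime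
with `q ≠ n`.  **The prime `𝔭_q` of `𝒪_K` with `𝔭_q² = (q)` is not principal**
(`not_isPrincipal_of_sq_eq_span`), equivalently its ideal class is non-trivial
(`classGroupMk0_ne_one_of_sq_eq_span`): the single-prime product `𝔭_q` is neither the empty product nor
the full product `∏_{p ∣ n} 𝔭_p` (there is a second prime `r ∣ n`, `r ≠ q`).  Classically: `x² + ny² = q`
(resp. the norm form of `𝒪_K` for `n ≡ 3 (mod 4)`) does not represent the proper divisor `q < n`.
By Artin reciprocity for the Hilbert class field (Cox, Cor. 5.25: `𝔭` splits completely in the Hilbert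
class field iff `𝔭` is principal) this is the statement «the Frobenius of `𝔭_q` is non-trivial on the
Hilbert class field», used by the cell `bsd-print-cf2` (crux stmt-BirchSwinnertonDyer-20509, even
two-prime sector `n = 2lq`: `𝔭_l` is not principal in `ℚ(√-2lq)`).

## References

* P. Stevenhagen, *Rédei-matrices and applications*, LMS LNS 215 (1995), §2 (proof of Thm. 1).
  [Stevenhagen1995RedeiMatrices]
* D. A. Cox, *Primes of the form x² + ny²*, 2nd ed. (2013), §5.C Thm. 5.23, Cor. 5.25 (PDF p. 124).
  [Cox2013]

## Mathlib / tree search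

Tree: `RedeiReichardt.eq_zero_or_eq_indicator_of_isPrincipal`, `exists_sq_eq_span`,
`eq_of_sq_eq_span_of_mem`, `isMaximal_of_sq_eq_span`, `mem_nonZeroDivisors_of_sq_eq_span`
(`RedeiReichardtRamifiedPrimes`, `RedeiReichardtPrincipalAmbiguous`).  Mathlib: `Finset.equivFin`,
`Fintype.prod_equiv`, `Nat.prod_primeFactors_of_squarefree`, `ClassGroup.mk0_eq_one_iff`.
-/

noncomputable section

open NumberField Ideal Module
open scoped nonZeroDivisors

namespace Literature.NumberTheory.QuadraticFields.RedeiReichardt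

variable {K : Type*} [Field K] [NumberField K]

/-- **A second prime divisor.** If `q ∣ n` is prime, `n` is square-free and `q ≠ n`, then some prime
`r ≠ q` divides `n`. [folklore] -/
private theorem exists_prime_dvd_ne {n q : ℕ} (hn : Squarefree n) (hq : q.Prime) (hqn : q ∣ n)
    (hqn' : q ≠ n) : ∃ r : ℕ, r.Prime ∧ r ∣ n ∧ r ≠ q := by
  obtain ⟨k, rfl⟩ := hqn
  have hk1 : k ≠ 1 := by rintro rfl; exact hqn' (mul_one q).symm
  obtain ⟨r, hr, hrk⟩ := Nat.exists_prime_and_dvd hk1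
  refine ⟨r, hr, Dvd.dvd.mul_left hrk q, ?_⟩
  rintro rfl
  obtain ⟨j, rfl⟩ := hrk
  exact hr.ne_one (Nat.isUnit_iff.mp (hn r ⟨j, by ring⟩))

/-- **The ramified prime above a proper prime divisor `q` of `n` is not principal** in a quadratic field
`K ∋ x`, `x² = -n` (`n` square-free, `q ∣ n` prime, `q ≠ n`; `P² = (q)`).  Proof: enumerate the primes
`p₁, …, p_t` of `disc K` (`= ∏ pᵢ`, i.e. the primes of `n`, together with `2` when `n ≡ 1 (mod 4)`) with
their ramified primes `𝔭ᵢ`; `P` is the `𝔭ᵢ₀` with `pᵢ₀ = q` (uniqueness of the prime above `q`); if it were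
principal, Stevenhagen's lemma (`eq_zero_or_eq_indicator_of_isPrincipal`) would make the exponent vector
`δ_{i₀}` either `0` or the indicator of `{i : pᵢ ∣ n}`, which contains a second index (`r ∣ n`, `r ≠ q`).
[cite: Stevenhagen1995RedeiMatrices, §2 (proof of Thm. 1)] [cite: Cox2013, §5.C Cor. 5.25 (PDF p. 124)] -/
theorem not_isPrincipal_of_sq_eq_span (h2 : finrank ℚ K = 2) {n : ℕ} (hn : Squarefree n) {x : 𝓞 K}
    (hx : x ^ 2 = -(n : 𝓞 K)) {q : ℕ} (hq : q.Prime) (hqn : q ∣ n) (hqn' : q ≠ n)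
    {P : Ideal (𝓞 K)} (hP : P ^ 2 = span {(q : 𝓞 K)}) : ¬ P.IsPrincipal := by
  classical
  intro hprinc
  -- `n ∉ {0, 1, 3}`
  have hn1 : n ≠ 1 := by rintro rfl; exact hq.ne_one (Nat.dvd_one.mp hqn)
  have hn3 : n ≠ 3 := by
    rintro rfl
    exact hqn' ((Nat.prime_dvd_prime_iff_eq hq Nat.prime_three).mp hqn)
  have hn0 : n ≠ 0 := Squarefree.ne_zero hn
  -- the primes of the discriminant: those of `m = n`, resp. `m = 2n` when `n ≡ 1 (mod 4)`
  set m : ℕ := if n % 4 = 1 then 2 * n else n with hm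
  have hnm : n ∣ m := by rw [hm]; split_ifs; exacts [Dvd.intro_left 2 rfl, dvd_rfl]
  have hm0 : m ≠ 0 := by rw [hm]; split_ifs <;> omega
  have hmsq : Squarefree m := by
    rw [hm]
    split_ifs with h4
    · exact Nat.squarefree_mul_iff.mpr
        ⟨Nat.coprime_two_left.mpr (Nat.odd_iff.mpr (by omega)), Nat.squarefree_two, hn⟩
    · exact hn
  set e := m.primeFactors.equivFin with he
  set t : ℕ := m.primeFactors.card with ht
  let p : Fin t → ℕ := fun i => ((e.symm i : m.primeFactors) : ℕ)
  have hp : ∀ i, (p i).Prime := fun i => Nat.prime_of_mem_primeFactors (e.symm i).2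
  have hinj : Function.Injective p := Subtype.val_injective.comp e.symm.injective
  have hprod : ∏ i, p i = m := by
    calc ∏ i, p i = ∏ s : m.primeFactors, (s : ℕ) := Fintype.prod_equiv e.symm _ _ fun _ => rfl
      _ = ∏ s ∈ m.primeFactors, s := Finset.prod_coe_sort m.primeFactors (fun j : ℕ => j)
      _ = m := Nat.prod_primeFactors_of_squarefree hmsq
  -- their ramified primes `𝔭ᵢ`, `𝔭ᵢ² = (pᵢ)`
  choose P' hP' using fun i => exists_sq_eq_span hx hp hinj hprod i
  -- `P = 𝔭ᵢ₀` for the index `i₀` of `q`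
  have hqm : q ∈ m.primeFactors := Nat.mem_primeFactors.mpr ⟨hq, hqn.trans hnm, hm0⟩
  set i₀ : Fin t := e ⟨q, hqm⟩ with hi₀
  have hpi₀ : p i₀ = q := by
    show ((e.symm (e ⟨q, hqm⟩) : m.primeFactors) : ℕ) = q
    rw [Equiv.symm_apply_apply]
  have hqP : (q : 𝓞 K) ∈ P :=
    Ideal.pow_le_self two_ne_zero (hP ▸ mem_span_singleton_self (q : 𝓞 K))
  have hPeq : P = P' i₀ :=
    eq_of_sq_eq_span_of_mem h2 (hp i₀) (hP' i₀) (isMaximal_of_sq_eq_span h2 hq hP).isPrime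
      (hpi₀.symm ▸ hqP)
  -- the exponent vector `δ_{i₀}`
  let e₀ : Fin t → ZMod 2 := fun i => if i = i₀ then 1 else 0
  have hsingle : ∏ i, P' i ^ (e₀ i).val = P' i₀ := by
    rw [Finset.prod_eq_single i₀ (fun i _ hi => by simp [e₀, hi]) (fun h => absurd (Finset.mem_univ _) h)]
    simp only [e₀, if_pos rfl]
    rw [show (1 : ZMod 2).val = 1 from rfl, pow_one]
  have hprinc' : (∏ i, P' i ^ (e₀ i).val).IsPrincipal := by rwa [hsingle, ← hPeq]
  rcases eq_zero_or_eq_indicator_of_isPrincipal h2 hx hp hinj hprod hP' hn1 hn3 e₀ hprinc' with h0 | h1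
  · -- `δ_{i₀} ≠ 0`
    have := congr_fun h0 i₀
    simp [e₀] at this
  · -- a second prime `r ∣ n`, `r ≠ q`, has exponent `0` in `δ_{i₀}` but `1` in the indicator
    obtain ⟨r, hr, hrn, hrq⟩ := exists_prime_dvd_ne hn hq hqn hqn'
    have hrm : r ∈ m.primeFactors := Nat.mem_primeFactors.mpr ⟨hr, hrn.trans hnm, hm0⟩
    have hi₁ : e ⟨r, hrm⟩ ≠ i₀ := by
      intro h
      exact hrq (congrArg (fun s : m.primeFactors => (s : ℕ)) (e.injective h))
    have hpi₁ : p (e ⟨r, hrm⟩) = r := by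
      show ((e.symm (e ⟨r, hrm⟩) : m.primeFactors) : ℕ) = r
      rw [Equiv.symm_apply_apply]
    have := congr_fun h1 (e ⟨r, hrm⟩)
    simp only [e₀, if_neg hi₁, hpi₁, if_pos hrn] at this
    exact zero_ne_one this

/-- **Class-group form**: the class of a prime `P` with `P² = (q)`, `q ∣ n` prime, `q ≠ n`, is not the
identity of `Cl(𝒪_K)` (`K ∋ √-n` quadratic, `n` square-free).
[cite: Stevenhagen1995RedeiMatrices, §2 (proof of Thm. 1)] [cite: Cox2013, §5.C Cor. 5.25 (PDF p. 124)] -/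
theorem classGroupMk0_ne_one_of_sq_eq_span (h2 : finrank ℚ K = 2) {n : ℕ} (hn : Squarefree n)
    {x : 𝓞 K} (hx : x ^ 2 = -(n : 𝓞 K)) {q : ℕ} (hq : q.Prime) (hqn : q ∣ n) (hqn' : q ≠ n)
    {P : Ideal (𝓞 K)} (hP : P ^ 2 = span {(q : 𝓞 K)}) (hP0 : P ∈ (Ideal (𝓞 K))⁰) :
    ClassGroup.mk0 ⟨P, hP0⟩ ≠ 1 := by
  rw [Ne, ClassGroup.mk0_eq_one_iff]
  exact not_isPrincipal_of_sq_eq_span h2 hn hx hq hqn hqn' hP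

/-- The same with the non-zero-divisor proof supplied (`P² = (q)` forces `P ≠ 0`).
[cite: Stevenhagen1995RedeiMatrices, §2 (proof of Thm. 1)] -/
theorem classGroupMk0_ne_one_of_sq_eq_span' (h2 : finrank ℚ K = 2) {n : ℕ} (hn : Squarefree n)
    {x : 𝓞 K} (hx : x ^ 2 = -(n : 𝓞 K)) {q : ℕ} (hq : q.Prime) (hqn : q ∣ n) (hqn' : q ≠ n)
    {P : Ideal (𝓞 K)} (hP : P ^ 2 = span {(q : 𝓞 K)}) :
    ClassGroup.mk0 ⟨P, mem_nonZeroDivisors_of_sq_eq_span h2 hq hP⟩ ≠ 1 :=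
  classGroupMk0_ne_one_of_sq_eq_span h2 hn hx hq hqn hqn' hP _

/-- **Existence form**: for every prime `q ∣ n`, `q ≠ n`, the ring of integers of `K ∋ √-n` has a
(unique) prime `𝔭_q = (q, √-n)` with `𝔭_q² = (q)`, and it is not principal.
[cite: Stevenhagen1995RedeiMatrices, §2 (proof of Thm. 1)] [cite: Cox2013, §5.C Cor. 5.25 (PDF p. 124)] -/
theorem exists_sq_eq_span_and_not_isPrincipal (h2 : finrank ℚ K = 2) {n : ℕ} (hn : Squarefree n)
    {x : 𝓞 K} (hx : x ^ 2 = -(n : 𝓞 K)) {q : ℕ} (hq : q.Prime) (hqn : q ∣ n) (hqn' : q ≠ n) :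
    ∃ P : Ideal (𝓞 K), P ^ 2 = span {(q : 𝓞 K)} ∧ P ∈ (Ideal (𝓞 K))⁰ ∧ ¬ P.IsPrincipal :=
  ⟨_, sq_span_pair_eq_span hn hx hq hqn, mem_nonZeroDivisors_of_sq_eq_span h2 hq
    (sq_span_pair_eq_span hn hx hq hqn), not_isPrincipal_of_sq_eq_span h2 hn hx hq hqn hqn'
      (sq_span_pair_eq_span hn hx hq hqn)⟩

end Literature.NumberTheory.QuadraticFields.RedeiReichardt

end
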